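import Literature.NumberTheory.EllipticCurves.ShuZhai2021.Base144a1
import Literature.NumberTheory.EllipticCurves.ZywinaCMImageProofs
import Literature.NumberTheory.EllipticCurves.OrdinaryPrimesProofs
import Literature.NumberTheory.EllipticCurves.PointCountEulerCriterion
import Literature.NumberTheory.EllipticCurves.ComplexMultiplicationLocalFactorsAux
import Literature.NumberTheory.EllipticCurves.Rank1Residual.Predicates
import HarnessLib

/-!
# Crux `KobayashiMainConjectureSmallImage` (stmt-BirchSwinnertonDyer-19002), line `birth_acns`:
# KERNEL WITNESS for the gen-8 reshape v4 → v5 — the v3/v4 engine stubs' arithmetic binders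
# `5 ≤ p → good p → a_p = 0 → ¬ Surj W p` are met by a CM pair, `(144a1, 5)`

Lead seat `bsd-line-slh-p3` gen 8, 2026-08-28. The engine stubs `stub_ES2rat_ns` / `stub_acDivRat_ns` of line v3/v4 were
cut from the bodies of cruxes stmt-20728 (rational) / stmt-20727 by the swap `Surj W p ↦ a_p = 0 → ¬ Surj W p`. This file
shows IN THE KERNEL that the swapped binder list does not exclude CM curves: Cremona's `144a1` (tree model `curve144a1 =
[0,3,0,3,0]`, `j = 0`, CM by `ℤ[ζ₃]`; `Literature/…/ShuZhai2021/Base144a1.lean`) at `p = 5` (inert in `ℚ(√−3)`) has good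
reduction (`5 ∤ Δ_min = −432`), `a_5 = 0` (`#Ẽ(𝔽₅) = 6`, kernel count by Euler's criterion) and NON-surjective mod-5 image
(tree theorem `WeierstrassCurve.not_hasSurjectiveModNGaloisRep_of_hasCM`, Zywina 2015 Prop. 1.14/1.16). Hence
`not_forall_engineBinders_imp_not_hasCM`: the v4 binders do not imply `¬ W.HasCM`, i.e. the v4 stubs quantified over CM
curves too — whereas the big-image originals (binder `Surj W p`) exclude them and the crux carries `¬ W.HasCM`. Line v5
(`Lines/birth_acns.lean`, glue p634633 `Theorems/…SmallImageAcanchorGlueRatRatNotCM.lean`) adds `¬ W.HasCM →` to both.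
(`144a1` is not itself on the crux's domain — it is CM; the point is only the scope of the registered engine statements.)
HONEST: nothing here bears on the truth of the crux; BSD is not proved by any of this.
-/

set_option autoImplicit false
set_option linter.dupNamespace false

noncomputable section

open scoped Classical

namespace Summit.BirchSwinnertonDyer.BirchSwinnertonDyer.Cruxes.KobayashiMainConjectureSmallImage.EngineDomainCMWitness

open WeierstrassCurve Literature.NumberTheory.EllipticCurves Literature.NumberTheory.EllipticCurves.ShuZhai2021
  Literature.NumberTheory.EllipticCurves.Rank1Residual

/-- The integral model of `144a1 = [0,3,0,3,0]` is `⟨0, 3, 0, 3, 0⟩`. [cite: Cremona1997, Table 1 (N = 144, curve A1)] -/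
theorem integralModelInt_curve144a1 [curve144a1.IsGloballyMinimal] :
    integralModelInt curve144a1 = ⟨0, 3, 0, 3, 0⟩ := by
  apply WeierstrassCurve.map_injective (f := Int.castRingHom ℚ) Int.cast_injective
  simp only [map_integralModelInt]
  ext <;> simp [curve144a1]

/-- `Δ_min(144a1) = −432 = −2⁴·3³`. [cite: Cremona1997, Table 1 (N = 144, curve A1)] -/
theorem minimalDiscriminantInt_curve144a1 [curve144a1.IsGloballyMinimal] :
    minimalDiscriminantInt curve144a1 = -432 := by
  rw [minimalDiscriminantInt, integralModelInt_curve144a1]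
  norm_num [WeierstrassCurve.Δ, WeierstrassCurve.b₂, WeierstrassCurve.b₄, WeierstrassCurve.b₆,
    WeierstrassCurve.b₈]

/-- The tree's `reductionPointCount 144a1 q` counts the points of `y² = x³ + 3x² + 3x` over `ℤ/q`.
[cite: Cremona1997, Table 1 (N = 144, curve A1)] -/
theorem reductionPointCount_curve144a1 [curve144a1.IsGloballyMinimal] (q : ℕ) :
    reductionPointCount curve144a1 q = Nat.card (⟨0, 3, 0, 3, 0⟩ : WeierstrassCurve (ZMod q)).toAffine.Point := by
  rw [reductionPointCount, integralModelInt_curve144a1]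
  have : (⟨0, 3, 0, 3, 0⟩ : WeierstrassCurve ℤ).map (Int.castRingHom (ZMod q)) = ⟨0, 3, 0, 3, 0⟩ := by
    ext <;> simp
  rw [this]

/-- **`#Ẽ(𝔽₅) = 6`** for `144a1` (points `O, (0,0), (2,±1), (4,±2)`; kernel count by Euler's criterion) — `5` is
supersingular (inert in the CM field `ℚ(√−3)`). [cite: Cremona1997, Table 1 (N = 144, curve A1)] -/
theorem reductionPointCount_curve144a1_five [curve144a1.IsGloballyMinimal] :
    reductionPointCount curve144a1 5 = 6 := by
  rw [reductionPointCount_curve144a1,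
    @WeierstrassCurve.natCard_point_eq_one_add_card (ZMod 5) (@ZMod.instField 5 ⟨by norm_num⟩) _ _ _
      (by decide +kernel),
    @card_sol_eq_sum_euler (ZMod 5) (@ZMod.instField 5 ⟨by norm_num⟩) _ _
      (by rw [ZMod.ringChar_zmod_n]; decide), ZMod.card]
  decide +kernel

/-- **`a_5(144a1) = 0`** (`a_p = p + 1 − #Ẽ(𝔽_p) = 6 − 6`). [cite: Cremona1997, Table 1 (N = 144, curve A1)] -/
theorem frobeniusTrace_curve144a1_five [curve144a1.IsGloballyMinimal] :
    curve144a1.frobeniusTrace 5 = 0 := by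
  rw [frobeniusTrace, reductionPointCount_curve144a1_five]
  norm_num

/-- **`144a1` has good reduction at `5`** (`5 ∤ Δ_min = −432`; tree `hasGoodReductionAtPrime_of_not_dvd`).
[cite: SilvermanAEC2009, VII.1 Remark 1.1] -/
theorem hasGoodReductionAtPrime_curve144a1_five [Fact (Nat.Prime 5)] [curve144a1.IsGloballyMinimal] :
    curve144a1.HasGoodReductionAtPrime 5 := by
  refine hasGoodReductionAtPrime_of_not_dvd curve144a1 5 ?_
  rw [minimalDiscriminantInt_curve144a1]
  decide

/-- **The v3/v4 engine binders hold at the CM pair `(144a1, 5)`**: `144a1` has CM, `5 ≤ 5`, good reduction at `5`,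
`a_5 = 0`, and NON-surjective mod-5 image (Zywina/Serre: a CM curve is never surjective at an odd prime).
[cite: Zywina2015, Prop. 1.14 and Prop. 1.16 (§1.9)] [cite: Cremona1997, Table 1 (N = 144, curve A1)] -/
theorem engineBinders_at_cm_pair [Fact (Nat.Prime 5)] :
    haveI := isGloballyMinimal_curve144a1
    curve144a1.HasCM ∧ 5 ≤ 5 ∧ curve144a1.HasGoodReductionAtPrime 5 ∧ curve144a1.frobeniusTrace 5 = 0 ∧
      ¬ Surj curve144a1 5 := by
  haveI := isGloballyMinimal_curve144a1
  haveI := isElliptic_curve144a1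
  exact ⟨hasCM_curve144a1, le_rfl, hasGoodReductionAtPrime_curve144a1_five, frobeniusTrace_curve144a1_five,
    curve144a1.not_hasSurjectiveModNGaloisRep_of_hasCM hasCM_curve144a1 (Fact.out) (by norm_num)⟩

/-- **The v3/v4 engine binder list does NOT exclude CM curves**: it is false that every globally minimal elliptic
`W/ℚ` and prime `p` with `5 ≤ p`, good reduction, `a_p = 0` and `¬ Surj W p` is non-CM (witness `(144a1, 5)`). So the
registered v4 statements `stub_ES2rat_ns` / `stub_acDivRat_ns` quantified over CM curves as well; v5 adds `¬ W.HasCM →`.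
[cite: Zywina2015, Prop. 1.14 and Prop. 1.16 (§1.9)] -/
theorem not_forall_engineBinders_imp_not_hasCM :
    ¬ (∀ (W : WeierstrassCurve ℚ) [W.IsElliptic] [W.IsGloballyMinimal] (p : ℕ) [Fact p.Prime],
        5 ≤ p → W.HasGoodReductionAtPrime p → W.frobeniusTrace p = 0 → ¬ Surj W p → ¬ W.HasCM) := by
  intro h
  haveI : Fact (Nat.Prime 5) := ⟨by norm_num⟩
  haveI := isGloballyMinimal_curve144a1
  haveI := isElliptic_curve144a1
  obtain ⟨hCM, h5, hgood, hap, hs⟩ := engineBinders_at_cm_pair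
  exact h curve144a1 5 h5 hgood hap hs hCM

end Summit.BirchSwinnertonDyer.BirchSwinnertonDyer.Cruxes.KobayashiMainConjectureSmallImage.EngineDomainCMWitness

end
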